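import Mathlib
import Literature.Computability.AlgebraicComplexity.MignonRessayreBound

/-!
# Iterated directional derivatives of the permanent at zeroed permutation matrices

Crux `GrenetZeon.TwoDimCoefficients` (stmt-ValiantsHypothesis-8062), line `dim2_cases`, stub
`stub_dualUnipotent` — the evaluation half of LEMMA_k of
`Cruxes/TwoDimCoefficients/TRIANGULARISABLE-RUNG.md` (order-`k` flat subspaces of `per_n`; the
dimension bound is `GrenetZeonTwoDimCoefficientsPermanentFlatOrder.lean`).

* `foldr_mkDerivation_eq_sum`: the iterated directional derivative `D_{d₀} ⋯ D_{d_{k-1}} g`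
  (`D_u = Σ_s u_s ∂_s = MvPolynomial.mkDerivation ℂ (C ∘ u)`) expands as
  `Σ_{s : Fin k → cells} (∏_t d_t(s_t)) · ∂_{s₀} ⋯ ∂_{s_{k-1}} g`.
* `foldr_pderiv_prod_X_perm`: iterated partials of a permutation monomial `∏_i X_{π i, i}`.
* `eval_testPoint_foldr_pderiv_perPoly`: at the TEST POINT `P_{τ,C}` (the permutation matrix of `τ`,
  entries `x_{τ j, j} = 1`, with the columns in `C` zeroed) the iterated partial `∂_{s₀}⋯∂_{s_{k-1}} per_n`
  counts the permutations `π` matching the derivative cells, agreeing with `τ` off the derivative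
  columns, the derivative columns being distinct and covering `C`.
* `testPoint_term_unique`, `eval_testPoint_iterD_perPoly` — **the pivot evaluation**: for pivots
  `(r_t, c_t)_{t<k}` (injective columns), `τ` with `τ c_t = r_t`, and directions `d_t` vanishing on the
  rows `r_j` and columns `c_j` with `j < t`, exactly ONE term survives:
  `(D_{d₀}⋯D_{d_{k-1}} per_n)(P_{τ, {c_t}}) = ∏_t d_t(r_t, c_t)`.  (A non-zero term forces the
  derivative columns to be the pivot columns via a self-map `φ` of `Fin k` with `φ ≥ id`, hence
  `φ = id` — `eq_self_of_injective_of_le` — and likewise for the rows.)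

HONEST FRAMING: elementary permanent calculus serving a sub-case rung of an ASIDE item; `VP ≠ VNP` is
not moved.

References: T. Mignon, N. Ressayre, Int. Math. Res. Not. 2004:79, §3 (iterated partials of the
permanent are sub-permanents); J. M. Landsberg, *Geometry and Complexity Theory* (2017), §6.4.6.
-/

set_option linter.dupNamespace false

noncomputable section

namespace Summit.ValiantsHypothesis.ValiantsHypothesis.Cruxes.TwoDimCoefficients.DimTwoCases

open MvPolynomial Matrix
open Literature.Computability.AlgebraicComplexity

section DirDeriv

variable {σ : Type*}

/-- `mkDerivation` kills constants. [folklore] -/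
theorem mkDerivation_const_eq_zero (f : σ → MvPolynomial σ ℂ) (a : ℂ) :
    mkDerivation ℂ f (C a : MvPolynomial σ ℂ) = 0 := by
  rw [← MvPolynomial.algebraMap_eq (R := ℂ) (σ := σ)]
  exact Derivation.map_algebraMap _ a

variable [Fintype σ]

/-- The derivation `mkDerivation ℂ (C ∘ u)` is the directional derivative `Σ_s u_s ∂_s`. [folklore] -/
theorem mkDerivation_C_apply_eq_sum [DecidableEq σ] (u : σ → ℂ) (f : MvPolynomial σ ℂ) :
    mkDerivation ℂ (fun s => (C (u s) : MvPolynomial σ ℂ)) f = ∑ s, C (u s) * pderiv s f := by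
  induction f using MvPolynomial.induction_on with
  | C a =>
      rw [mkDerivation_const_eq_zero]
      simp
  | add p q hp hq =>
      simp only [map_add, hp, hq, mul_add, Finset.sum_add_distrib]
  | mul_X p i hp =>
      rw [Derivation.leibniz, mkDerivation_X, hp, smul_eq_mul, smul_eq_mul]
      simp only [Derivation.leibniz, pderiv_X, smul_eq_mul, mul_add, Finset.sum_add_distrib]
      have h1 : ∑ s, C (u s) * (p * Pi.single (M := fun _ => MvPolynomial σ ℂ) s 1 i) =
          p * C (u i) := by
        rw [Finset.sum_eq_single i]
        · simp [mul_comm]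
        · intro s _ hs
          rw [Pi.single_eq_of_ne (Ne.symm hs), mul_zero, mul_zero]
        · simp
      rw [h1]
      congr 1
      rw [Finset.mul_sum]
      exact Finset.sum_congr rfl fun s _ => by ring

end DirDeriv

section IterDeriv

variable {n : ℕ}

/-- Iterated partial derivatives of a permutation monomial `∏_{i ∈ S} X_{π i, i}` along a list of
cells: non-zero only if the columns are distinct, lie in `S`, and the rows match `π`; then the
product loses exactly those columns. [folklore] -/
theorem foldr_pderiv_prod_X_perm (π : Equiv.Perm (Fin n)) (S : Finset (Fin n))
    (l : List (Fin n × Fin n)) :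
    l.foldr (fun c f => pderiv c f) (∏ i ∈ S, (X (π i, i) : MvPolynomial (Fin n × Fin n) ℂ)) =
      if (l.map Prod.snd).Nodup ∧ (∀ c ∈ l, c.2 ∈ S ∧ π c.2 = c.1) then
        ∏ i ∈ S \ (l.map Prod.snd).toFinset, X (π i, i) else 0 := by
  classical
  induction l with
  | nil => simp
  | cons c l ih =>
      rw [List.foldr_cons, ih]
      by_cases hl : (l.map Prod.snd).Nodup ∧ ∀ c' ∈ l, c'.2 ∈ S ∧ π c'.2 = c'.1
      · rw [if_pos hl, pderiv_prod_X_perm]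
        have hset : (S \ (l.map Prod.snd).toFinset).erase c.2 =
            S \ ((c :: l).map Prod.snd).toFinset := by
          ext i
          simp only [Finset.mem_erase, Finset.mem_sdiff, List.mem_toFinset, List.map_cons,
            List.mem_cons]
          tauto
        by_cases hc : c.2 ∈ S \ (l.map Prod.snd).toFinset ∧ π c.2 = c.1
        · rw [if_pos hc, hset, if_pos]
          refine ⟨?_, ?_⟩
          · rw [List.map_cons, List.nodup_cons]
            exact ⟨fun h => (Finset.mem_sdiff.mp hc.1).2 (List.mem_toFinset.mpr h), hl.1⟩
          · intro c' hc'
            rcases List.mem_cons.mp hc' with rfl | h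
            · exact ⟨(Finset.mem_sdiff.mp hc.1).1, hc.2⟩
            · exact hl.2 c' h
        · rw [if_neg hc, if_neg]
          rintro ⟨hnd, hall⟩
          apply hc
          rw [List.map_cons, List.nodup_cons] at hnd
          refine ⟨Finset.mem_sdiff.mpr ⟨(hall c (List.mem_cons_self)).1, ?_⟩,
            (hall c (List.mem_cons_self)).2⟩
          intro h
          exact hnd.1 (List.mem_toFinset.mp h)
      · rw [if_neg hl, map_zero, if_neg]
        rintro ⟨hnd, hall⟩
        apply hl
        rw [List.map_cons, List.nodup_cons] at hnd
        exact ⟨hnd.2, fun c' h => hall c' (List.mem_cons_of_mem _ h)⟩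

/-- Iterated partial derivatives are additive. [folklore] -/
theorem foldr_pderiv_sum {ι : Type*} (s : Finset ι) (f : ι → MvPolynomial (Fin n × Fin n) ℂ)
    (l : List (Fin n × Fin n)) :
    l.foldr (fun c g => pderiv c g) (∑ x ∈ s, f x) = ∑ x ∈ s, l.foldr (fun c g => pderiv c g) (f x) := by
  induction l with
  | nil => simp
  | cons c l ih => rw [List.foldr_cons, ih, map_sum]; simp only [List.foldr_cons]

/-- Iterated directional derivatives expand into iterated partial derivatives:
`D_{d₀} ⋯ D_{d_{k-1}} g = Σ_s (∏_t d_t(s_t)) · ∂_{s₀} ⋯ ∂_{s_{k-1}} g`. [folklore] -/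
theorem foldr_mkDerivation_eq_sum {k : ℕ} (d : Fin k → (Fin n × Fin n → ℂ))
    (g : MvPolynomial (Fin n × Fin n) ℂ) :
    (List.ofFn d).foldr
        (fun u f => mkDerivation ℂ (fun s => (C (u s) : MvPolynomial (Fin n × Fin n) ℂ)) f) g =
      ∑ s : Fin k → Fin n × Fin n,
        C (∏ t, d t (s t)) * (List.ofFn s).foldr (fun c f => pderiv c f) g := by
  classical
  induction k with
  | zero => simp
  | succ k ih =>
      rw [List.ofFn_succ, List.foldr_cons, ih (fun i => d i.succ), map_sum]
      have hre : (∑ s : Fin (k + 1) → Fin n × Fin n,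
            C (∏ t, d t (s t)) * (List.ofFn s).foldr (fun c f => pderiv c f) g) =
          ∑ cs : (Fin n × Fin n) × (Fin k → Fin n × Fin n),
            C (∏ t, d t (Fin.cons (α := fun _ => Fin n × Fin n) cs.1 cs.2 t)) *
              (List.ofFn (Fin.cons (α := fun _ => Fin n × Fin n) cs.1 cs.2)).foldr
                (fun c f => pderiv c f) g :=
        (Fintype.sum_equiv (Fin.consEquiv fun _ => Fin n × Fin n) _ _ (fun cs => rfl)).symm
      rw [hre, Fintype.sum_prod_type, Finset.sum_comm]
      refine Finset.sum_congr rfl fun s' _ => ?_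
      rw [Derivation.leibniz, mkDerivation_const_eq_zero, smul_zero, add_zero, smul_eq_mul,
        mkDerivation_C_apply_eq_sum, Finset.mul_sum]
      refine Finset.sum_congr rfl fun c _ => ?_
      rw [Fin.prod_univ_succ, Fin.cons_zero, List.ofFn_succ, Fin.cons_zero, List.foldr_cons, map_mul]
      simp only [Fin.cons_succ]
      ring

/-- The permanent as a sum of permutation monomials (column-indexed). [folklore] -/
theorem perPoly_eq_sum_prod :
    perPoly (Fin n) ℂ = ∑ π : Equiv.Perm (Fin n), ∏ i, (X (π i, i) : MvPolynomial (Fin n × Fin n) ℂ) := by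
  simp only [perPoly, Matrix.permanent, Matrix.mvPolynomialX_apply]

/-- **Iterated derivatives of the permanent at a zeroed permutation matrix.** At the point
`P_{τ,C}` (permutation matrix of `τ` with the columns in `C` zeroed), `∂_{s₀}⋯∂_{s_{k-1}} per_n`
evaluates to the number of permutations `π` agreeing with `τ` off the derivative columns, matching the
derivative cells, provided the derivative columns are distinct and cover `C`. [folklore] -/
theorem eval_testPoint_foldr_pderiv_perPoly {k : ℕ} (τ : Equiv.Perm (Fin n)) (Ccols : Finset (Fin n))
    (s : Fin k → Fin n × Fin n) :
    eval (fun rc : Fin n × Fin n => if rc.2 ∉ Ccols ∧ rc.1 = τ rc.2 then (1 : ℂ) else 0)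
        ((List.ofFn s).foldr (fun c f => pderiv c f) (perPoly (Fin n) ℂ)) =
      ∑ π : Equiv.Perm (Fin n),
        if ((List.ofFn s).map Prod.snd).Nodup ∧ (∀ t, π (s t).2 = (s t).1) ∧
            (∀ i, i ∉ ((List.ofFn s).map Prod.snd).toFinset → (i ∉ Ccols ∧ π i = τ i))
        then 1 else 0 := by
  classical
  rw [perPoly_eq_sum_prod, foldr_pderiv_sum, map_sum]
  refine Finset.sum_congr rfl fun π _ => ?_
  rw [foldr_pderiv_prod_X_perm]
  have hmem : (∀ c ∈ List.ofFn s, c.2 ∈ (Finset.univ : Finset (Fin n)) ∧ π c.2 = c.1) ↔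
      ∀ t, π (s t).2 = (s t).1 := by
    constructor
    · intro h t
      exact (h (s t) (List.mem_ofFn.mpr ⟨t, rfl⟩)).2
    · intro h c hc
      obtain ⟨t, rfl⟩ := List.mem_ofFn.mp hc
      exact ⟨Finset.mem_univ _, h t⟩
  by_cases h1 : ((List.ofFn s).map Prod.snd).Nodup ∧ ∀ t, π (s t).2 = (s t).1
  · rw [if_pos (⟨h1.1, hmem.mpr h1.2⟩ : _ ∧ _), map_prod]
    simp only [eval_X]
    rw [Finset.prod_boole]
    by_cases h2 : ∀ i, i ∉ ((List.ofFn s).map Prod.snd).toFinset → (i ∉ Ccols ∧ π i = τ i)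
    · have h2' : ∀ i ∈ Finset.univ \ ((List.ofFn s).map Prod.snd).toFinset, i ∉ Ccols ∧ π i = τ i :=
        fun i hi => h2 i (Finset.mem_sdiff.mp hi).2
      rw [if_pos h2', if_pos ⟨h1.1, h1.2, h2⟩]
    · have h2' : ¬ ∀ i ∈ Finset.univ \ ((List.ofFn s).map Prod.snd).toFinset, i ∉ Ccols ∧ π i = τ i :=
        fun hall => h2 fun i hi => hall i (Finset.mem_sdiff.mpr ⟨Finset.mem_univ _, hi⟩)
      rw [if_neg h2', if_neg (fun h => h2 h.2.2)]
  · rw [if_neg (fun h => h1 ⟨h.1, hmem.mp h.2⟩), map_zero, if_neg (fun h => h1 ⟨h.1, h.2.1⟩)]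

end IterDeriv

/-! ### The pivot evaluation: only one term survives -/

section Pivot

variable {n k : ℕ}

/-- An injective self-map of `Fin k` that is pointwise `≥ id` is the identity. [folklore] -/
theorem eq_self_of_injective_of_le (φ : Fin k → Fin k) (hφ : Function.Injective φ)
    (hle : ∀ t, t ≤ φ t) (t : Fin k) : φ t = t := by
  have hbij : Function.Bijective φ := Finite.injective_iff_bijective.mp hφ
  have hsum : ∑ t, (φ t).val = ∑ t : Fin k, t.val :=
    Equiv.sum_comp (Equiv.ofBijective φ hbij) (fun t => t.val)
  have h := (Finset.sum_eq_sum_iff_of_le (f := fun t : Fin k => t.val) (g := fun t => (φ t).val)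
    (fun t _ => (hle t : t.val ≤ (φ t).val))).mp hsum.symm
  exact Fin.ext (h t (Finset.mem_univ _)).symm

/-- **Uniqueness of the surviving term.** With pivots `(r_t, c_t)` (injective), a permutation `τ`
with `τ c_t = r_t`, and directions `d_t` vanishing on the rows `r_j` and columns `c_j` for
`j < t`: if the term indexed by `(s, π)` of the test-point evaluation is non-zero, then
`s_t = (r_t, c_t)` for all `t` and `π = τ`. [folklore] -/
theorem testPoint_term_unique (r c : Fin k → Fin n)
    (hc : Function.Injective c) (τ : Equiv.Perm (Fin n)) (hτ : ∀ t, τ (c t) = r t)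
    (d : Fin k → (Fin n × Fin n → ℂ))
    (hdr : ∀ t j, j < t → ∀ y, d t (r j, y) = 0) (hdc : ∀ t j, j < t → ∀ x, d t (x, c j) = 0)
    (s : Fin k → Fin n × Fin n) (π : Equiv.Perm (Fin n))
    (hnd : ((List.ofFn s).map Prod.snd).Nodup) (hrow : ∀ t, π (s t).2 = (s t).1)
    (hoff : ∀ i, i ∉ ((List.ofFn s).map Prod.snd).toFinset → (i ∉ Finset.univ.image c ∧ π i = τ i))
    (hnz : ∀ t, d t (s t) ≠ 0) :
    (∀ t, s t = (r t, c t)) ∧ π = τ := by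
  classical
  -- the derivative columns are exactly the pivot columns
  have hinjcol : Function.Injective fun t => (s t).2 := by
    rw [List.map_ofFn] at hnd
    exact List.nodup_ofFn.mp hnd
  have hB : ((List.ofFn s).map Prod.snd).toFinset = Finset.univ.image fun t => (s t).2 := by
    ext i
    simp [List.mem_ofFn]
  have hCB : Finset.univ.image c ⊆ Finset.univ.image fun t => (s t).2 := by
    intro i hi
    by_contra hni
    rw [← hB] at hni
    exact (hoff i hni).1 hi
  have hBC : (Finset.univ.image fun t => (s t).2) = Finset.univ.image c := by
    refine (Finset.eq_of_subset_of_card_le hCB ?_).symm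
    rw [Finset.card_image_of_injective _ hc]
    exact Finset.card_image_le.trans (by simp)
  have hcol' : ∀ t, ∃ j, (s t).2 = c j := by
    intro t
    have : (s t).2 ∈ Finset.univ.image c := by
      rw [← hBC]; exact Finset.mem_image_of_mem _ (Finset.mem_univ t)
    obtain ⟨j, -, hj⟩ := Finset.mem_image.mp this
    exact ⟨j, hj.symm⟩
  choose φ hφ using hcol'
  have hφinj : Function.Injective φ := by
    intro t t' h
    apply hinjcol
    simp only [hφ, h]
  have hφle : ∀ t, t ≤ φ t := by
    intro t
    by_contra hlt
    push Not at hlt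
    apply hnz t
    have : s t = ((s t).1, c (φ t)) := by rw [← hφ]
    rw [this]
    exact hdc t (φ t) hlt _
  have hφid := eq_self_of_injective_of_le φ hφinj hφle
  have hcol : ∀ t, (s t).2 = c t := fun t => by rw [hφ, hφid]
  -- the rows: `π (c t) ∈ range r`
  have hrow' : ∀ t, ∃ j, π (c t) = r j := by
    intro t
    set y := τ.symm (π (c t)) with hy
    by_cases hyC : y ∈ Finset.univ.image c
    · obtain ⟨j, -, hj⟩ := Finset.mem_image.mp hyC
      refine ⟨j, ?_⟩
      rw [← hτ j, hj, hy, Equiv.apply_symm_apply]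
    · have hyB : y ∉ ((List.ofFn s).map Prod.snd).toFinset := by rwa [hB, hBC]
      have h2 := (hoff y hyB).2
      rw [hy, Equiv.apply_symm_apply] at h2
      have : y = c t := π.injective h2
      exact absurd (this ▸ Finset.mem_image_of_mem c (Finset.mem_univ t)) hyC
  choose ψ hψ using hrow'
  have hψinj : Function.Injective ψ := by
    intro t t' h
    have : π (c t) = π (c t') := by rw [hψ, hψ, h]
    exact hc (π.injective this)
  have hψle : ∀ t, t ≤ ψ t := by
    intro t
    by_contra hlt
    push Not at hlt
    apply hnz t
    have : s t = (r (ψ t), c t) := by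
      rw [← hψ, ← hcol t, hrow t]
    rw [this]
    exact hdr t (ψ t) hlt _
  have hψid := eq_self_of_injective_of_le ψ hψinj hψle
  have hπc : ∀ t, π (c t) = r t := fun t => by rw [hψ, hψid]
  refine ⟨fun t => ?_, ?_⟩
  · refine Prod.ext ?_ (hcol t)
    rw [← hrow t, hcol t, hπc]
  · refine Equiv.ext fun i => ?_
    by_cases hi : i ∈ Finset.univ.image c
    · obtain ⟨t, -, rfl⟩ := Finset.mem_image.mp hi
      rw [hπc, hτ]
    · have hiB : i ∉ ((List.ofFn s).map Prod.snd).toFinset := by rwa [hB, hBC]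
      exact (hoff i hiB).2

/-- **The pivot evaluation.** Under the hypotheses of `testPoint_term_unique`, the `k`-th directional
derivative `D_{d₀}⋯D_{d_{k-1}} per_n` at the test point (permutation matrix of `τ` with the pivot
columns zeroed) equals `∏_t d_t(r_t, c_t)`. [folklore] -/
theorem eval_testPoint_iterD_perPoly (r c : Fin k → Fin n)
    (hc : Function.Injective c) (τ : Equiv.Perm (Fin n)) (hτ : ∀ t, τ (c t) = r t)
    (d : Fin k → (Fin n × Fin n → ℂ))
    (hdr : ∀ t j, j < t → ∀ y, d t (r j, y) = 0) (hdc : ∀ t j, j < t → ∀ x, d t (x, c j) = 0) :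
    eval (fun rc : Fin n × Fin n =>
        if rc.2 ∉ Finset.univ.image c ∧ rc.1 = τ rc.2 then (1 : ℂ) else 0)
      ((List.ofFn d).foldr
        (fun u f => mkDerivation ℂ (fun s => (C (u s) : MvPolynomial (Fin n × Fin n) ℂ)) f)
        (perPoly (Fin n) ℂ)) = ∏ t, d t (r t, c t) := by
  classical
  rw [foldr_mkDerivation_eq_sum, map_sum]
  simp_rw [map_mul, eval_C, eval_testPoint_foldr_pderiv_perPoly]
  set s₀ : Fin k → Fin n × Fin n := fun t => (r t, c t) with hs₀
  -- the term `(s₀, τ)` and nothing else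
  have hcond₀ : ((List.ofFn s₀).map Prod.snd).Nodup ∧ (∀ t, τ (s₀ t).2 = (s₀ t).1) ∧
      (∀ i, i ∉ ((List.ofFn s₀).map Prod.snd).toFinset → (i ∉ Finset.univ.image c ∧ τ i = τ i)) := by
    refine ⟨?_, fun t => hτ t, fun i hi => ⟨?_, rfl⟩⟩
    · rw [List.map_ofFn]
      exact List.nodup_ofFn.mpr hc
    · intro hic
      apply hi
      rw [List.mem_toFinset, List.map_ofFn, List.mem_ofFn]
      obtain ⟨t, -, rfl⟩ := Finset.mem_image.mp hic
      exact ⟨t, rfl⟩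
  have hvanish : ∀ s π, (s ≠ s₀ ∨ π ≠ τ) →
      (∏ t, d t (s t)) * (if ((List.ofFn s).map Prod.snd).Nodup ∧ (∀ t, π (s t).2 = (s t).1) ∧
        (∀ i, i ∉ ((List.ofFn s).map Prod.snd).toFinset → (i ∉ Finset.univ.image c ∧ π i = τ i))
        then (1 : ℂ) else 0) = 0 := by
    intro s π hne
    by_cases hz : ∃ t, d t (s t) = 0
    · obtain ⟨t, ht⟩ := hz
      rw [Finset.prod_eq_zero (Finset.mem_univ t) ht, zero_mul]
    · push Not at hz
      rw [if_neg, mul_zero]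
      rintro ⟨h1, h2, h3⟩
      obtain ⟨hs, hπ⟩ := testPoint_term_unique r c hc τ hτ d hdr hdc s π h1 h2 h3 hz
      rcases hne with hne | hne
      · exact hne (funext hs)
      · exact hne hπ
  rw [Finset.sum_eq_single s₀]
  · rw [Finset.mul_sum, Finset.sum_eq_single τ]
    · rw [if_pos hcond₀, mul_one]
    · intro π _ hπ
      exact hvanish s₀ π (Or.inr hπ)
    · intro h; exact absurd (Finset.mem_univ _) h
  · intro s _ hs
    rw [Finset.mul_sum]
    exact Finset.sum_eq_zero fun π _ => hvanish s π (Or.inl hs)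
  · intro h; exact absurd (Finset.mem_univ _) h

end Pivot

end Summit.ValiantsHypothesis.ValiantsHypothesis.Cruxes.TwoDimCoefficients.DimTwoCases

end
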